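import Mathlib
import Summits.AtomisticToContinuum.HydrodynamicLimit.Theorems.ImplosionDichotomyDenseExcursionCavityMatching
import Summits.AtomisticToContinuum.HydrodynamicLimit.Theorems.ImplosionDichotomyDenseExcursionCavityCentreBound

/-!
# The canonical centre branches: uniqueness from the centre normalisation and Lipschitz continuity in `Λ` (T7(i) (γ))
# (crux `DenseExcursion`, line `sonic-cavity-renewal`, brick for stub `stub_cavityResolventCk`)

Helper file (`--supports stmt-AtomisticToContinuum-12586`, line lead a2, stub-worker E2 for `stub_cavityResolventCk`).
Two registered helpers on the centre side of theorem T7(i):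

* `centre_branch_unique_of_limit` — regular solutions of `Λŵ − linW = f`, `Λŝ − linS = g` on `x ≤ −X` with the same
  CENTRE NORMALISATION `eʸŝ(y) → c₀` coincide on `x ≤ −X` (their difference is a regular homogeneous solution, hence a
  multiple `a·E_c` of the canonical homogeneous branch of `centre_branch_bound` (`centre_regular_unique`), and
  `eʸ·(difference) → 0 = a·1`). So "the" particular solution (`c₀ = 0`) and "the" homogeneous branch (`c₀ = 1`) are
  well defined, and every bound proved for the constructed ones holds for them.
* `centre_branch_lipschitz` ((γ) at the centre) — for `‖Λ‖, ‖Λ′‖ ≤ R₀` the canonical homogeneous branches `E_c(Λ)`,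
  `E_c(Λ′)` (limit `1`) satisfy `‖E_c(Λ)‖_w ≤ Lc` and `‖E_c(Λ) − E_c(Λ′)‖_w ≤ Lc‖Λ − Λ′‖` in the weighted sup on `x ≤ −X`:
  the DIFFERENCE TRICK — `D = E_c(Λ) − E_c(Λ′)` solves the `Λ′`-equation with the regular source `(Λ′ − Λ)·E_c(Λ)` (weighted
  size `≤ Cc‖Λ − Λ′‖`) and centre limit `0`, so it IS the canonical particular solution of `centre_branch_bound` at `Λ′`,
  bounded by `Cc·(Cc‖Λ − Λ′‖)`.

Sources: folklore. Everything proved; no new definitions.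
-/

noncomputable section

open Set Filter
open scoped Topology ContDiff

namespace Summit.AtomisticToContinuum.HydrodynamicLimit.Theorems.SonicCavityRenewal

open Summit.AtomisticToContinuum.HydrodynamicLimit.Theorems.R2OneModeTwoConditions

/-- A pair normalised by `eʸŝ(y) → c₀ ≠ 0` at the centre has `ŝ ≠ 0` at some point of every half-line `y ≤ −X`. [folklore] -/
theorem exists_ne_zero_of_centre_limit {ŝ : ℝ → ℂ} {c₀ : ℂ} {X : ℝ} (hc₀ : c₀ ≠ 0)
    (hlim : Tendsto (fun y : ℝ => (Real.exp y : ℂ) * ŝ y) atBot (𝓝 c₀)) : ∃ y ∈ Iic (-X), ŝ y ≠ 0 := by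
  have hev : ∀ᶠ y in atBot, (Real.exp y : ℂ) * ŝ y ≠ 0 :=
    hlim.eventually (isOpen_ne.mem_nhds hc₀)
  obtain ⟨y, hy, hyX⟩ := (hev.and (Iic_mem_atBot (-X))).exists
  exact ⟨y, hyX, fun h => hy (by rw [h, mul_zero])⟩

/-- **Registered helper `centre_branch_unique_of_limit`: REGULAR SOLUTIONS ON `x ≤ −X` WITH THE SAME SOURCE AND THE SAME
CENTRE NORMALISATION COINCIDE.** See the module docstring. [folklore] -/
theorem centre_branch_unique_of_limit : ∀ (r : ℝ) (W S : ℝ → ℝ), IsMonatomicProfile r W S → CavityTube r W S → ∀ (Λ : ℂ) (X : ℝ), 0 < X → ∀ (f g ŵ₁ ŝ₁ ŵ₂ ŝ₂ : ℝ → ℂ) (c₀ : ℂ), IsRegularPair ŵ₁ ŝ₁ → IsRegularPair ŵ₂ ŝ₂ → (∀ x ∈ Set.Iic (-X), Λ * ŵ₁ x - linW r W S ŵ₁ ŝ₁ x = f x ∧ Λ * ŝ₁ x - linS r W S ŵ₁ ŝ₁ x = g x) → (∀ x ∈ Set.Iic (-X), Λ * ŵ₂ x - linW r W S ŵ₂ ŝ₂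 x = f x ∧ Λ * ŝ₂ x - linS r W S ŵ₂ ŝ₂ x = g x) → Tendsto (fun y : ℝ => (Real.exp y : ℂ) * ŝ₁ y) atBot (𝓝 c₀) → Tendsto (fun y : ℝ => (Real.exp y : ℂ) * ŝ₂ y) atBot (𝓝 c₀) → ∀ x ∈ Set.Iic (-X), ŵ₁ x = ŵ₂ x ∧ ŝ₁ x = ŝ₂ x := by
  intro r W S hP hT Λ X hX f g ŵ₁ ŝ₁ ŵ₂ ŝ₂ c₀ h₁ h₂ hsol₁ hsol₂ hlim₁ hlim₂
  -- the canonical homogeneous branch at `Λ`, normalised by the centre limit `1`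
  obtain ⟨Cc, -, hbr⟩ := centre_branch_bound r W S hP hT X ‖Λ‖ hX
  obtain ⟨wc, sc, hregc, hsolc, hlimc, -⟩ := hbr Λ le_rfl (fun _ => 0) (fun _ => 0) isRegularPair_zero 0
    (fun y _ => by simp) 1
  have hsolc' : ∀ x ∈ Iic (-X), Λ * wc x = linW r W S wc sc x ∧ Λ * sc x = linS r W S wc sc x := fun x hx =>
    ⟨sub_eq_zero.1 (hsolc x hx).1, sub_eq_zero.1 (hsolc x hx).2⟩
  have hnec : ∃ x ∈ Iic (-X), wc x ≠ 0 ∨ sc x ≠ 0 := by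
    obtain ⟨y, hy, hne⟩ := exists_ne_zero_of_centre_limit (X := X) one_ne_zero hlimc
    exact ⟨y, hy, Or.inr hne⟩
  -- the difference is a regular homogeneous solution with centre limit `0`
  have d₁ : Differentiable ℝ ŵ₁ := h₁.1.differentiable (by simp)
  have d₁' : Differentiable ℝ ŝ₁ := h₁.2.1.differentiable (by simp)
  have d₂ : Differentiable ℝ ŵ₂ := h₂.1.differentiable (by simp)
  have d₂' : Differentiable ℝ ŝ₂ := h₂.2.1.differentiable (by simp)
  have hregD : IsRegularPair (fun x => ŵ₁ x - ŵ₂ x) (fun x => ŝ₁ x - ŝ₂ x) := isRegularPair_sub h₂ h₁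
  have hsolD : ∀ x ∈ Iic (-X), Λ * (ŵ₁ x - ŵ₂ x) = linW r W S (fun y => ŵ₁ y - ŵ₂ y) (fun y => ŝ₁ y - ŝ₂ y) x ∧
      Λ * (ŝ₁ x - ŝ₂ x) = linS r W S (fun y => ŵ₁ y - ŵ₂ y) (fun y => ŝ₁ y - ŝ₂ y) x := by
    intro x hx
    obtain ⟨a1, a2⟩ := hsol₁ x hx
    obtain ⟨b1, b2⟩ := hsol₂ x hx
    rw [linW_sub d₂ d₂' d₁ d₁', linS_sub d₂ d₂' d₁ d₁']
    exact ⟨by linear_combination a1 - b1, by linear_combination a2 - b2⟩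
  obtain ⟨a, ha⟩ := centre_regular_unique r W S hP hT Λ X hX.le _ _ wc sc hregD hregc hsolD hsolc' hnec
  -- the centre limits force `a = 0`
  have hlimD : Tendsto (fun y : ℝ => (Real.exp y : ℂ) * (ŝ₁ y - ŝ₂ y)) atBot (𝓝 0) := by
    have := hlim₁.sub hlim₂
    rw [sub_self] at this
    exact this.congr fun y => by ring
  have hlimA : Tendsto (fun y : ℝ => (Real.exp y : ℂ) * (ŝ₁ y - ŝ₂ y)) atBot (𝓝 (a * 1)) := by
    refine (hlimc.const_mul a).congr' ?_
    filter_upwards [Iic_mem_atBot (-X)] with y hy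
    rw [(ha y hy).2]; ring
  have ha0 : a = 0 := by have := tendsto_nhds_unique hlimA hlimD; simpa using this
  intro x hx
  obtain ⟨e1, e2⟩ := ha x hx
  rw [ha0, zero_mul] at e1 e2
  exact ⟨sub_eq_zero.1 e1, sub_eq_zero.1 e2⟩

/-- **Registered helper `centre_branch_lipschitz` (T7(i) (γ) at the centre): THE CANONICAL HOMOGENEOUS CENTRE BRANCH IS
BOUNDED AND LIPSCHITZ IN `Λ`, in the weighted sup on `x ≤ −X`, uniformly on `‖Λ‖ ≤ R₀`.** See the module docstring.
[folklore] -/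
theorem centre_branch_lipschitz : ∀ (r : ℝ) (W S : ℝ → ℝ), IsMonatomicProfile r W S → CavityTube r W S → ∀ (X R₀ : ℝ), 0 < X → ∃ Lc : ℝ, 0 < Lc ∧ ∀ (Λ Λ' : ℂ), ‖Λ‖ ≤ R₀ → ‖Λ'‖ ≤ R₀ → ∀ (ŵ ŝ ŵ' ŝ' : ℝ → ℂ), IsRegularPair ŵ ŝ → IsRegularPair ŵ' ŝ' → (∀ x ∈ Set.Iic (-X), Λ * ŵ x = linW r W S ŵ ŝ x ∧ Λ * ŝ x = linS r W S ŵ ŝ x) → (∀ x ∈ Set.Iic (-X), Λ' * ŵ' x = linW r W S ŵ' ŝ' x ∧ Λ' * ŝ' x = linS r W S ŵ' ŝ' x) → Tendsto (fun y : ℝ => (Real.exp y : ℂ) * ŝ y) atBot (𝓝 1) → Tendsto (fun y : ℝ => (Real.exp y : ℂ) * ŝ' y) atBot (𝓝 1) → ∀ y : ℝ, y ≤ -X → ‖ŵ y‖ + Real.exp y * ‖ŝ y‖ ≤ Lc ∧ ‖ŵ y - ŵ' y‖ + Real.exp y * ‖ŝ y - ŝ' y‖ ≤ Lc * ‖Λ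 - Λ'‖ := by
  intro r W S hP hT X R₀ hX
  obtain ⟨Cc, hCc, hbr⟩ := centre_branch_bound r W S hP hT X R₀ hX
  refine ⟨Cc + Cc * Cc, by positivity, fun Λ Λ' hΛ hΛ' ŵ ŝ ŵ' ŝ' h h' hsol hsol' hlim hlim' => ?_⟩
  have hsub : ∀ {Λ₀ : ℂ} {w s : ℝ → ℂ}, (∀ x ∈ Iic (-X), Λ₀ * w x = linW r W S w s x ∧ Λ₀ * s x = linS r W S w s x) →
      ∀ x ∈ Iic (-X), Λ₀ * w x - linW r W S w s x = (fun _ => (0 : ℂ)) x ∧ Λ₀ * s x - linS r W S w s x = (fun _ => (0 : ℂ)) x :=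
    fun hs x hx => ⟨sub_eq_zero.2 (hs x hx).1, sub_eq_zero.2 (hs x hx).2⟩
  -- the branch at `Λ` is the constructed one, hence bounded by `Cc`
  obtain ⟨wB, sB, hregB, hsolB, hlimB, hbdB⟩ := hbr Λ hΛ (fun _ => 0) (fun _ => 0) isRegularPair_zero 0
    (fun y _ => by simp) 1
  have heqB := centre_branch_unique_of_limit r W S hP hT Λ X hX _ _ ŵ ŝ wB sB 1 h hregB (hsub hsol) hsolB hlim hlimB
  have hbd : ∀ y, y ≤ -X → ‖ŵ y‖ + Real.exp y * ‖ŝ y‖ ≤ Cc := by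
    intro y hy
    obtain ⟨e1, e2⟩ := heqB y hy
    have := hbdB y hy
    rw [e1, e2]; simpa using this
  -- the difference solves the `Λ'`-equation with source `(Λ' − Λ)·(ŵ, ŝ)` and centre limit `0`
  have d : Differentiable ℝ ŵ := h.1.differentiable (by simp)
  have d' : Differentiable ℝ ŝ := h.2.1.differentiable (by simp)
  have e : Differentiable ℝ ŵ' := h'.1.differentiable (by simp)
  have e' : Differentiable ℝ ŝ' := h'.2.1.differentiable (by simp)
  have hregD : IsRegularPair (fun x => ŵ x - ŵ' x) (fun x => ŝ x - ŝ' x) := isRegularPair_sub h' h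
  have hregF : IsRegularPair (fun x => (Λ' - Λ) * ŵ x) (fun x => (Λ' - Λ) * ŝ x) := isRegularPair_const_mul _ h
  have hsolD : ∀ x ∈ Iic (-X), Λ' * (ŵ x - ŵ' x) - linW r W S (fun y => ŵ y - ŵ' y) (fun y => ŝ y - ŝ' y) x = (Λ' - Λ) * ŵ x ∧
      Λ' * (ŝ x - ŝ' x) - linS r W S (fun y => ŵ y - ŵ' y) (fun y => ŝ y - ŝ' y) x = (Λ' - Λ) * ŝ x := by
    intro x hx
    obtain ⟨a1, a2⟩ := hsol x hx
    obtain ⟨b1, b2⟩ := hsol' x hx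
    rw [linW_sub e e' d d', linS_sub e e' d d']
    exact ⟨by linear_combination a1 - b1, by linear_combination a2 - b2⟩
  have hN : ∀ y, y ≤ -X → ‖(Λ' - Λ) * ŵ y‖ + Real.exp y * ‖(Λ' - Λ) * ŝ y‖ ≤ ‖Λ - Λ'‖ * Cc := by
    intro y hy
    rw [norm_mul, norm_mul, ← norm_neg (Λ' - Λ), neg_sub]
    have := hbd y hy
    have h0 : 0 ≤ ‖Λ - Λ'‖ := norm_nonneg _
    nlinarith [this, h0]
  obtain ⟨wP, sP, hregP, hsolP, hlimP, hbdP⟩ := hbr Λ' hΛ' _ _ hregF (‖Λ - Λ'‖ * Cc) hN 0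
  have hlimD : Tendsto (fun y : ℝ => (Real.exp y : ℂ) * (ŝ y - ŝ' y)) atBot (𝓝 0) := by
    have := hlim.sub hlim'
    rw [sub_self] at this
    exact this.congr fun y => by ring
  have heqP := centre_branch_unique_of_limit r W S hP hT Λ' X hX _ _ _ _ wP sP 0 hregD hregP hsolD hsolP hlimD hlimP
  refine fun y hy => ⟨(hbd y hy).trans (by nlinarith), ?_⟩
  obtain ⟨e1, e2⟩ := heqP y hy
  have := hbdP y hy
  rw [norm_zero, zero_add] at this
  rw [e1, e2]
  calc ‖wP y‖ + Real.exp y * ‖sP y‖ ≤ Cc * (‖Λ - Λ'‖ * Cc) := this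
    _ ≤ (Cc + Cc * Cc) * ‖Λ - Λ'‖ := by nlinarith [norm_nonneg (Λ - Λ')]

end Summit.AtomisticToContinuum.HydrodynamicLimit.Theorems.SonicCavityRenewal

end
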